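import Literature.NumberTheory.Automorphic.UnitaryGroupCentralizerCovolSplit
import HarnessLib

/-!
# The unitary group of a `1 × 1` hermitian form is the norm-one torus `L¹`, WHICHEVER the form: `U(h)(𝔸) = U(h′)(𝔸)` with the same
# rational points, and covolume weights are transported along isomorphisms of `cmDatum` adelic groups
(Rogawski 1990 §3.8 Prop. 3.8.1 (a) p. 30 «`G_γ ≅ U(2) × U(1)`», §14.5 Lemma 14.5.2 (b) p. 238 «`m(E¹∖𝔸¹_E)`»; Gelbart 1975 Remark 9.23)

Topic `NumberTheory/Automorphic`; namespace `Literature.NumberTheory.Automorphic.UnitaryGroup`.  THEOREMS ONLY (no definition, no instance, no notation,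
no named fact, no `sorry`).  Cell `pub/hodgecm-mathlib`, crux H413 = stmt-HodgeConjecture-24833, half A line LH5 (closer stub `stub_S1finTFCovol`, letter ★
`Rogawski1990.TamagawaSingularMembersFinTFCovol`, conjunct (T′)); organ «R2J» (rank-2 reduction junction), CM half, prover seat LH5-p03 (g0) — the companion of
`UnitaryGroupCentralizerCovolTwoDocks` (`covol_centralizer_eq_of_docks`, hypothesis `hb`).  Count-neutral plumbing.  HONEST LABEL: HC_CM is proved only modulo
the printed citations until rung 0 closes.

WHY.  In (T′) the two docked centralisers `Z(γ_c ⊗ 1) ≅ U(H_a)(𝔸) × U(H_b)(𝔸)`, `Z(γ_{c′} ⊗ 1) ≅ U(H_a′)(𝔸) × U(H_b′)(𝔸)` of stably conjugate singular classes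
carry `1 × 1` blocks `H_b = (h_b)`, `H_b′ = (h_b′)` — the `H′`-lengths of the simple-eigenvalue eigenvectors, well defined modulo `N(Lˣ)` only and in general NOT
congruent (`h_b′ ∕ h_b ∉ N(Lˣ)`), so ★ `adelicUnitaryGroupCongr` does not relate them.  But for a `1 × 1` form the unitary condition `σ(g)·h·g = h` is
`σ(g)·g = 1` as soon as `h` is a unit: `U(h) = U(h′) = L¹` as subgroups of `GL₁`, over `L` and over `𝔸_L` alike.  Hence the identity of `GL₁(𝔸_L)`
is an isomorphism of topological groups `U(h_b)(𝔸) ≃ₜ* U(h_b′)(𝔸)` carrying rational points onto rational points, and the rank-1 covolumes of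
`covol_centralizer_eq_of_docks` agree for transported Haar measures — the `hb` of that junction is discharged in-house.

* §1 (any commutative ring `R`, endomorphism `σ`): `mem_unitaryGroup_iff_of_fin_one` — for `H ∈ M₁(R)` with `H₀₀` a unit, `g ∈ U_σ(H) ↔ σ(g₀₀)·g₀₀ = 1`;
  `unitaryGroup_eq_of_fin_one` — `U_σ(H) = U_σ(H′)` for two such forms.
* §2 (generic, private: equal subgroups of a topological group are `≃ₜ*` by the identity; CM): `unitaryGroup_cmConj_eq_of_fin_one`, `adelicUnitaryGroup_eq_of_fin_one` (rational and adelic points), and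
  **`exists_continuousMulEquiv_cmDatum_fin_one`** — `∃ ι : U(h)(𝔸) ≃ₜ* U(h′)(𝔸)`, the identity on `GL₁(𝔸_L)`, with `ι u` rational `↔ u` rational
  (lattice clause in the `quotientSubgroup` currency of the covolume weights).
* §3 (CM, any sizes `N`, `N′`): **`covol_cmDatum_eq_of_continuousMulEquiv`** — covolume weights `vol(U(H)(L⁺)∖U(H)(𝔸); t)` are transported along any
  `ι : U(H)(𝔸) ≃ₜ* U(H′)(𝔸)` with the lattice clause and `ι_* t = t′` (★ `covolume_count_eq_of_mulEquiv'` with the `cmDatum` lattice-side instances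
  discharged); **`covol_cmDatum_fin_one_eq`** — §2 ∘ §3: for `1 × 1` forms, `vol(U(h)(L⁺)∖U(h)(𝔸); t) = vol(U(h′)(L⁺)∖U(h′)(𝔸); ι_* t)`.

## References
* [Rogawski1990] J. D. Rogawski, *Automorphic Representations of Unitary Groups in Three Variables*, Ann. of Math. Stud. 123 (1990), §3.8 Prop. 3.8.1 (a)
  p. 30; §14.5 Lemma 14.5.2 (b) pp. 238–239.
* [Gelbart1975] S. Gelbart, *Automorphic forms on adele groups*, Ann. of Math. Stud. 83 (1975), Remark 9.23 p. 155.
-/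

set_option autoImplicit false

noncomputable section

open MeasureTheory MeasureTheory.Measure Topology Set NumberField
open Literature.MeasureTheory.Group
open scoped ENNReal MatrixGroups Matrix

namespace Literature.NumberTheory.Automorphic

open Literature.AlgebraicGeometry.ShimuraVarieties (unitaryGroup mem_unitaryGroup_iff)

namespace UnitaryGroup

/-! ## §1 `1 × 1` forms over a commutative ring -/

section FinOne

variable {R : Type*} [CommRing R] (σ : R →+* R)

/-- For a `1 × 1` matrix `H` whose entry is a unit, `g ∈ U_σ(H)` iff `σ(g₀₀) · g₀₀ = 1`: the unitary group of a rank-one form is the norm-one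
torus, independently of the form. [cite: Rogawski1990, §3.8 Prop. 3.8.1 (a) p. 30] -/
theorem mem_unitaryGroup_iff_of_fin_one (H : Matrix (Fin 1) (Fin 1) R) (hH : IsUnit (H 0 0)) (g : GL (Fin 1) R) :
    g ∈ unitaryGroup σ H ↔ σ ((g : Matrix (Fin 1) (Fin 1) R) 0 0) * (g : Matrix (Fin 1) (Fin 1) R) 0 0 = 1 := by
  rw [mem_unitaryGroup_iff]
  have key : (((g : Matrix (Fin 1) (Fin 1) R).map σ)ᵀ * H * (g : Matrix (Fin 1) (Fin 1) R)) =
      Matrix.of (fun _ _ : Fin 1 => (σ ((g : Matrix (Fin 1) (Fin 1) R) 0 0) * (g : Matrix (Fin 1) (Fin 1) R) 0 0) * H 0 0) := by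
    ext i j
    fin_cases i; fin_cases j
    simp [Matrix.mul_apply, Matrix.transpose_apply, Matrix.map_apply]
    ring
  rw [key]
  constructor
  · intro h
    have h00 := congrArg (fun M : Matrix (Fin 1) (Fin 1) R => M 0 0) h
    simp only [Matrix.of_apply] at h00
    -- `(σ g₀₀ · g₀₀) · H₀₀ = H₀₀` with `H₀₀` a unit
    obtain ⟨u, hu⟩ := hH
    rw [← hu] at h00
    have := congrArg (fun x : R => x * ((u⁻¹ : Rˣ) : R)) h00
    simpa [mul_assoc, Units.mul_inv] using this
  · intro h
    ext i j
    fin_cases i; fin_cases j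
    simp [h]

/-- Two `1 × 1` forms with unit entries have THE SAME unitary group (both are the norm-one torus `{g : σ(g) g = 1}`).
[cite: Rogawski1990, §3.8 Prop. 3.8.1 (a) p. 30] -/
theorem unitaryGroup_eq_of_fin_one (H H' : Matrix (Fin 1) (Fin 1) R) (hH : IsUnit (H 0 0)) (hH' : IsUnit (H' 0 0)) :
    unitaryGroup σ H = unitaryGroup σ H' :=
  Subgroup.ext fun g => by rw [mem_unitaryGroup_iff_of_fin_one σ H hH, mem_unitaryGroup_iff_of_fin_one σ H' hH']

end FinOne

/-! ## §2 Equal subgroups are isomorphic topological groups by the identity (generic), and the CM instance `U(h)(𝔸) = U(h′)(𝔸)` -/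

section SubgroupEq

variable {G : Type*} [Group G] [TopologicalSpace G]

/-- Equal subgroups `S = S′` of a topological group are isomorphic AS TOPOLOGICAL GROUPS by the identity of `G`: `∃ ι : S ≃ₜ* S′` with `↑(ι u) = ↑u`
(Mathlib's `MulEquiv.subgroupCongr`, both directions continuous as restrictions of the identity).  Stated for an abstract `G` on purpose: the value
clause is `rfl` here and is then INSTANTIATED at concrete carriers (a `rfl` at `GL₁(𝔸_L)` makes the kernel compare the two membership predicates). [folklore] -/
private theorem exists_continuousMulEquiv_of_subgroup_eq (S S' : Subgroup G) (h : S = S') :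
    ∃ ι : ↥S ≃ₜ* ↥S', ∀ u : ↥S, ((ι u : ↥S') : G) = (u : G) :=
  ⟨{ MulEquiv.subgroupCongr h with
      continuous_toFun := Continuous.subtype_mk continuous_subtype_val _
      continuous_invFun := Continuous.subtype_mk continuous_subtype_val _ }, fun _ => rfl⟩

end SubgroupEq

section CM

variable (L : Type) [Field L] [NumberField L] [IsCMField L]
  (Hb Hb' : Matrix (Fin 1) (Fin 1) L)

/-- The rational points agree: `U(h)(L⁺) = U(h′)(L⁺)` for `1 × 1` forms with non-zero entries. [cite: Rogawski1990, §3.8 Prop. 3.8.1 (a) p. 30] -/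
theorem unitaryGroup_cmConj_eq_of_fin_one (hb : Hb 0 0 ≠ 0) (hb' : Hb' 0 0 ≠ 0) :
    unitaryGroup (cmConjRingHom L) Hb = unitaryGroup (cmConjRingHom L) Hb' :=
  unitaryGroup_eq_of_fin_one (cmConjRingHom L) Hb Hb' (IsUnit.mk0 _ hb) (IsUnit.mk0 _ hb')

/-- The adelic points agree: `U(h)(𝔸_{L⁺}) = U(h′)(𝔸_{L⁺})` for `1 × 1` forms with non-zero entries (a non-zero element of `L` is a unit of `𝔸_L`).
[cite: Rogawski1990, §14.5 Lemma 14.5.2 (b) p. 238] -/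
theorem adelicUnitaryGroup_eq_of_fin_one (hb : Hb 0 0 ≠ 0) (hb' : Hb' 0 0 ≠ 0) :
    adelicUnitaryGroup L Hb = adelicUnitaryGroup L Hb' := by
  unfold adelicUnitaryGroup
  refine unitaryGroup_eq_of_fin_one (adeleConj L) _ _ ?_ ?_
  · simpa only [Matrix.map_apply] using (IsUnit.mk0 _ hb).map (algebraMap L (AdeleRing (𝓞 L) L))
  · simpa only [Matrix.map_apply] using (IsUnit.mk0 _ hb').map (algebraMap L (AdeleRing (𝓞 L) L))

/-- **The identity of `GL₁(𝔸_L)` is an isomorphism of topological groups `U(h)(𝔸) ≃ₜ* U(h′)(𝔸)` carrying rational points onto rational points.**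
For `1 × 1` forms `h, h′` with non-zero entries there is `ι : (cmDatum L 1 h).Adelic ≃ₜ* (cmDatum L 1 h′).Adelic` with `↑(ι u) = ↑u` in `GL₁(𝔸_L)` and
`ι u ∈ U(h′)(L⁺) ↔ u ∈ U(h)(L⁺)` (the lattice clause in the `quotientSubgroup` currency of the covolume weights; `A_G = 1`).
[cite: Rogawski1990, §3.8 Prop. 3.8.1 (a) p. 30; §14.5 Lemma 14.5.2 (b) p. 238] [cite: Gelbart1975, Remark 9.23] -/
theorem exists_continuousMulEquiv_cmDatum_fin_one (hb : Hb 0 0 ≠ 0) (hb' : Hb' 0 0 ≠ 0) :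
    ∃ ι : (cmDatum L 1 Hb).Adelic ≃ₜ* (cmDatum L 1 Hb').Adelic,
      (∀ u : (cmDatum L 1 Hb).Adelic, ((ι u).val : GL (Fin 1) (AdeleRing (𝓞 L) L)) = (u.val : GL (Fin 1) (AdeleRing (𝓞 L) L))) ∧
      (∀ u : (cmDatum L 1 Hb).Adelic, ι u ∈ (cmDatum L 1 Hb').quotientSubgroup ↔ u ∈ (cmDatum L 1 Hb).quotientSubgroup) := by
  have hrat := unitaryGroup_cmConj_eq_of_fin_one L Hb Hb' hb hb'
  obtain ⟨ι, hι⟩ := exists_continuousMulEquiv_of_subgroup_eq (adelicUnitaryGroup L Hb) (adelicUnitaryGroup L Hb')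
    (adelicUnitaryGroup_eq_of_fin_one L Hb Hb' hb hb')
  refine ⟨ι, hι, fun u => ?_⟩
  -- both lattices are the diagonal images of the (equal, `hrat`) rational unitary groups, read on the common underlying `GL₁(𝔸_L)`-point
  have e1 : u ∈ (cmDatum L 1 Hb).quotientSubgroup ↔
      ∃ g ∈ unitaryGroup (cmConjRingHom L) Hb, toAdeleGL L g = (u.val : GL (Fin 1) (AdeleRing (𝓞 L) L)) :=
    (SetLike.ext_iff.mp (cmDatum_quotientSubgroup L 1 Hb) u).trans (mem_adelicUnitaryRat_iff L Hb u)
  have e2 : ι u ∈ (cmDatum L 1 Hb').quotientSubgroup ↔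
      ∃ g ∈ unitaryGroup (cmConjRingHom L) Hb', toAdeleGL L g = ((ι u).val : GL (Fin 1) (AdeleRing (𝓞 L) L)) :=
    (SetLike.ext_iff.mp (cmDatum_quotientSubgroup L 1 Hb') (ι u)).trans (mem_adelicUnitaryRat_iff L Hb' (ι u))
  have e3 : (∃ g ∈ unitaryGroup (cmConjRingHom L) Hb', toAdeleGL L g = ((ι u).val : GL (Fin 1) (AdeleRing (𝓞 L) L))) ↔
      ∃ g ∈ unitaryGroup (cmConjRingHom L) Hb, toAdeleGL L g = (u.val : GL (Fin 1) (AdeleRing (𝓞 L) L)) := by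
    rw [hrat, hι u]
  exact e2.trans (e3.trans e1.symm)

end CM

/-! ## §3 Covolume weights are transported along isomorphisms of `cmDatum` adelic groups -/

section Covol

variable (L : Type) [Field L] [NumberField L] [IsCMField L]
  {N N' : ℕ} (H : Matrix (Fin N) (Fin N) L) (H' : Matrix (Fin N') (Fin N') L)
  [MeasurableSpace (cmDatum L N H).Adelic] [BorelSpace (cmDatum L N H).Adelic]
  [MeasurableSpace (cmDatum L N' H').Adelic] [BorelSpace (cmDatum L N' H').Adelic]
  [MeasurableSpace ((cmDatum L N H).Adelic ⧸ (cmDatum L N H).quotientSubgroup)]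
  [BorelSpace ((cmDatum L N H).Adelic ⧸ (cmDatum L N H).quotientSubgroup)]
  [MeasurableSpace ((cmDatum L N' H').Adelic ⧸ (cmDatum L N' H').quotientSubgroup)]
  [BorelSpace ((cmDatum L N' H').Adelic ⧸ (cmDatum L N' H').quotientSubgroup)]
  [(count : Measure ↥(cmDatum L N H).quotientSubgroup).IsHaarMeasure] [(count : Measure ↥(cmDatum L N' H').quotientSubgroup).IsHaarMeasure]

/-- **Covolume weights are transport-invariant along isomorphisms of `cmDatum` adelic groups**: for `ι : U(H)(𝔸) ≃ₜ* U(H′)(𝔸)` carrying rational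
points onto rational points (`ι u ∈ U(H′)(L⁺) ↔ u ∈ U(H)(L⁺)`) and a Haar measure `t` with `ι_* t = t′`,
`vol(U(H)(L⁺)∖U(H)(𝔸); t) = vol(U(H′)(L⁺)∖U(H′)(𝔸); t′)` (counting measures on the lattices).  ★ `covolume_count_eq_of_mulEquiv'` with the lattice-side
instances discharged (★ `countable_cmDatum_quotientSubgroup`, Borel ∕ T₂; `count` Haar on the lattices is the standing binder of the (K7-s) frame,
★ `isHaarMeasure_count_quotientSubgroup`-dischargeable). [cite: Gelbart1975, Remark 9.23] [cite: Rogawski1990, §14.5 Lemma 14.5.2 (b) p. 238] -/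
theorem covol_cmDatum_eq_of_continuousMulEquiv
    (hq : IsClosed (((cmDatum L N H).quotientSubgroup : Subgroup (cmDatum L N H).Adelic) : Set (cmDatum L N H).Adelic))
    (hq' : IsClosed (((cmDatum L N' H').quotientSubgroup : Subgroup (cmDatum L N' H').Adelic) : Set (cmDatum L N' H').Adelic))
    (ι : (cmDatum L N H).Adelic ≃ₜ* (cmDatum L N' H').Adelic)
    (hι : ∀ u, ι u ∈ (cmDatum L N' H').quotientSubgroup ↔ u ∈ (cmDatum L N H).quotientSubgroup)
    (t : Measure (cmDatum L N H).Adelic) [IsHaarMeasure t] [t.IsMulRightInvariant]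
    (t' : Measure (cmDatum L N' H').Adelic) [IsHaarMeasure t'] [t'.IsMulRightInvariant]
    (ht : Measure.map ι t = t') :
    quotientMeasure (cmDatum L N H).quotientSubgroup count hq t Set.univ =
      quotientMeasure (cmDatum L N' H').quotientSubgroup count hq' t' Set.univ := by
  haveI : MeasurableSingletonClass (cmDatum L N H).Adelic := inferInstance
  haveI : MeasurableSingletonClass (cmDatum L N' H').Adelic := inferInstance
  haveI := countable_cmDatum_quotientSubgroup L N H
  haveI := countable_cmDatum_quotientSubgroup L N' H'
  haveI : IsClosed (((cmDatum L N H).quotientSubgroup : Subgroup (cmDatum L N H).Adelic) : Set (cmDatum L N H).Adelic) := hq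
  haveI : IsClosed (((cmDatum L N' H').quotientSubgroup : Subgroup (cmDatum L N' H').Adelic) : Set (cmDatum L N' H').Adelic) := hq'
  exact covolume_count_eq_of_mulEquiv' ι.toMulEquiv ι.continuous ι.symm.continuous
    ((cmDatum L N H).quotientSubgroup) ((cmDatum L N' H').quotientSubgroup) hι t t' ht

end Covol

section CovolFinOne

variable (L : Type) [Field L] [NumberField L] [IsCMField L]
  (Hb Hb' : Matrix (Fin 1) (Fin 1) L)
  [MeasurableSpace (cmDatum L 1 Hb).Adelic] [BorelSpace (cmDatum L 1 Hb).Adelic]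
  [MeasurableSpace (cmDatum L 1 Hb').Adelic] [BorelSpace (cmDatum L 1 Hb').Adelic]
  [MeasurableSpace ((cmDatum L 1 Hb).Adelic ⧸ (cmDatum L 1 Hb).quotientSubgroup)]
  [BorelSpace ((cmDatum L 1 Hb).Adelic ⧸ (cmDatum L 1 Hb).quotientSubgroup)]
  [MeasurableSpace ((cmDatum L 1 Hb').Adelic ⧸ (cmDatum L 1 Hb').quotientSubgroup)]
  [BorelSpace ((cmDatum L 1 Hb').Adelic ⧸ (cmDatum L 1 Hb').quotientSubgroup)]
  [(count : Measure ↥(cmDatum L 1 Hb).quotientSubgroup).IsHaarMeasure] [(count : Measure ↥(cmDatum L 1 Hb').quotientSubgroup).IsHaarMeasure]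

/-- **The rank-1 covolumes of (T′) agree.**  For `1 × 1` forms `h_b`, `h_b′` with non-zero entries and any Haar measure `t` on `U(h_b)(𝔸)` there is an
isomorphism of topological groups `ι : U(h_b)(𝔸) ≃ₜ* U(h_b′)(𝔸)` (the identity of `GL₁(𝔸_L)`, §2) with
`vol(U(h_b)(L⁺)∖U(h_b)(𝔸); t) = vol(U(h_b′)(L⁺)∖U(h_b′)(𝔸); ι_* t)` — the hypothesis `hb` of ★-to-be `covol_centralizer_eq_of_docks` for the `L¹`-blocks
of two Rogawski frames [§14.5 p. 238 «`m(E¹∖𝔸¹_E)`», the same factor for every class]. [cite: Rogawski1990, §14.5 Lemma 14.5.2 (b) p. 238] [cite: Gelbart1975, Remark 9.23] -/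
theorem covol_cmDatum_fin_one_eq (hb : Hb 0 0 ≠ 0) (hb' : Hb' 0 0 ≠ 0)
    (hq : IsClosed (((cmDatum L 1 Hb).quotientSubgroup : Subgroup (cmDatum L 1 Hb).Adelic) : Set (cmDatum L 1 Hb).Adelic))
    (hq' : IsClosed (((cmDatum L 1 Hb').quotientSubgroup : Subgroup (cmDatum L 1 Hb').Adelic) : Set (cmDatum L 1 Hb').Adelic))
    (t : Measure (cmDatum L 1 Hb).Adelic) [IsHaarMeasure t] [t.IsMulRightInvariant] :
    ∃ ι : (cmDatum L 1 Hb).Adelic ≃ₜ* (cmDatum L 1 Hb').Adelic,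
      (∀ u : (cmDatum L 1 Hb).Adelic, ((ι u).val : GL (Fin 1) (AdeleRing (𝓞 L) L)) = (u.val : GL (Fin 1) (AdeleRing (𝓞 L) L))) ∧
      (∀ u : (cmDatum L 1 Hb).Adelic, ι u ∈ (cmDatum L 1 Hb').quotientSubgroup ↔ u ∈ (cmDatum L 1 Hb).quotientSubgroup) ∧
      ∃ (_ : IsHaarMeasure (Measure.map ι t)) (_ : (Measure.map ι t).IsMulRightInvariant),
      quotientMeasure (cmDatum L 1 Hb).quotientSubgroup count hq t Set.univ =
        quotientMeasure (cmDatum L 1 Hb').quotientSubgroup count hq' (Measure.map ι t) Set.univ := by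
  obtain ⟨ι, hιv, hιq⟩ := exists_continuousMulEquiv_cmDatum_fin_one L Hb Hb' hb hb'
  haveI h1 : IsHaarMeasure (Measure.map ι t) := ι.isHaarMeasure_map t
  haveI h2 : (Measure.map ι t).IsMulRightInvariant := by
    have hme : Measurable (fun x => ι x) := ι.continuous.measurable
    refine ⟨fun h => ?_⟩
    rw [Measure.map_map (measurable_mul_const h) hme]
    obtain ⟨g, rfl⟩ := ι.surjective h
    conv_rhs => rw [← map_mul_right_eq_self t g]
    rw [Measure.map_map hme (measurable_mul_const g)]
    congr 1
    ext x
    simp only [Function.comp_apply, map_mul]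
  exact ⟨ι, hιv, hιq, h1, h2, covol_cmDatum_eq_of_continuousMulEquiv L Hb Hb' hq hq' ι hιq t (Measure.map ι t) rfl⟩

end CovolFinOne

end UnitaryGroup

end Literature.NumberTheory.Automorphic

end
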